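/- LEAD seat `ym-line-cbag-p1` (prover-ym-line-cbag-p1-g29-0), LINE 7b (`GlueballBandRecursion`, volume-comparison line): the line's SECOND assembly, in
the FINITE currency of width seat w2 g23's remark R1 — `ColdFreeEnergyVolumeJets → TraceExcessFloorAllSides → TraceExcessVolumeComparisonSmallCoupling`
(no tube rate: two finite boxes per volume), hence `→ ColdDoublingRecursionSmallCoupling`.  Sorry-free; `--supports stmt-QuantumFields-22957 --as helper`. -/
import Summits.QuantumFields.YangMills.Theorems.GlueballBandRecursionVolumeComparisonOfJets
import HarnessLib

/-!
# Route `GlueballBandRecursion`, line 7b: the volume comparison from jet agreement of the cold log-defect (finite currency)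

Objects (`…ThermalFreeEnergyDefs`, v2): `coldLogDefect ρ a t z = 2·log Z(a³×t)(z) − log Z(a³×2t)(z)` and its density discrepancy
`coldVolumeDiscrepancy ρ a a' t z = coldLogDefect ρ a' t z/a'³ − coldLogDefect ρ a t z/a³`; the stub `ColdFreeEnergyVolumeJets`
(`coldVolumeDiscrepancy r.ρ a a' t =O[𝓝 0] z^{3a}` for `4 ≤ a ≤ a'`, `4 ≤ t`).  Proved here:

* §1 `coldLogDefect = 2·thermalLogZ(a,t) − thermalLogZ(a,2t)` (the `t·e_a` normalisers cancel), so it is holomorphic and `≤ 48a³t` in norm on the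
  strong-coupling disc, the discrepancy is `≤ 96t`, and the Schwarz step gives `‖coldVolumeDiscrepancy z‖ ≤ 96t·(‖z‖/(r_ρ/2))^k` from `=O z^k`;
* §2 at real `0 ≤ β ≤ r_ρ`: `Re coldLogDefect ρ a (m+2) β = −log(Z_β(a³×2(m+2))/Z_β(a³×(m+2))²) = −log(1 − δᶜ_{m+2}(a))` (module XII's dictionary);
* §3 uniform smallness off the diagonal: `x_{m+2}(N) ≤ ε` for all `N ≥ N₁` with `N ≤ 20(m+2)` and all `0 ≤ β ≤ r_ρ` (needed at the larger volume
  `L' ≤ 4L` at the smaller volume's cold time `⌊L/4⌋`);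
* §4 ASSEMBLY `traceExcessVolumeComparisonSmallCoupling_of_coldJets` (`K = 520`): with `δ = δᶜ_t(L)`, `δ' = δᶜ_t(L')`, `Δ = −log(1−δ)`,
  `Δ' = −log(1−δ')`, `D = Re coldVolumeDiscrepancy = Δ'/L'³ − Δ/L³`: `Δ' ≤ 64Δ + 64L³|D|`, `64L³|D| ≤ 4·(cβ)^L ≤ 4(cβ⁴)^t ≤ 4x_t(L)` (budget + floor),
  `Δ ≤ 2δ ≤ 4x_t(L)`, `δ' ≤ Δ'`, `x_t(L') ≤ 2δ'` (dictionary, `x_t(L') ≤ 1` by §3) ⇒ `x_t(L') ≤ 520·x_t(L)`; and `coldDoublingRecursionSmallCoupling_of_coldJets`.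

Either currency closes line 7b down to ONE combinatorial stub plus the all-sides floor; this one asks the crew for jets of two FINITE boxes only.

HONEST FRAMING.  Implications only; the hypotheses are OPEN here; the target is a RECORD-type strong-coupling rung; nothing bears on weak coupling or on
the Yang–Mills mass gap (Clay), which is NOT proved by anything in this file.
-/

set_option autoImplicit false

noncomputable section

open Filter Topology Asymptotics MeasureTheory
open Literature.Probability.LatticeModels (pertLogZ)
open Literature.MathematicalPhysics.QuantumFieldTheory
open Literature.MathematicalPhysics.QuantumFieldTheory.Balaban1983to89.Missing
open Summit.QuantumFields.YangMills.Cruxes.IR.ColdPurityBridge (one_sub_ratio_le_two_mul_traceExcess one_sub_ratio_ge_of_traceExcess)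

namespace Summit.QuantumFields.YangMills.Theorems.GlueballBandRecursion.Thermal

/-! ## §1 The cold log-defect on the strong-coupling disc -/

section Analytic

variable {G : Type*} [Group G] [TopologicalSpace G] [IsTopologicalGroup G] [CompactSpace G] [MeasurableSpace G] [BorelSpace G]
  {n : ℕ} (ρ : G →* Matrix (Fin n) (Fin n) ℂ)

/-- The tube-rate normalisers cancel: `coldLogDefect ρ a t = 2·thermalLogZ ρ a t − thermalLogZ ρ a (2t)`. -/
theorem coldLogDefect_eq (a t : ℕ) (z : ℂ) : coldLogDefect ρ a t z = 2 * thermalLogZ ρ a t z - thermalLogZ ρ a (2 * t) z := by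
  unfold coldLogDefect thermalLogZ
  push_cast
  ring

/-- `‖coldLogDefect ρ a t z‖/a³ ≤ 48 t` on the disc (`a, t ≥ 1`). -/
theorem norm_coldLogDefect_div_le (hρ : Continuous ρ) {a t : ℕ} (ha : 0 < a) (ht : 1 ≤ t) {z : ℂ} (hz : ‖z‖ ≤ strongCouplingRadius ρ) :
    ‖coldLogDefect ρ a t z / ((a : ℂ) ^ 3)‖ ≤ 48 * (t : ℝ) := by
  rw [coldLogDefect_eq, sub_div, mul_div_assoc]
  refine (norm_sub_le _ _).trans ?_
  have h1 := norm_thermalLogZ_div_le ρ hρ ha ht hz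
  have h2 := norm_thermalLogZ_div_le ρ hρ ha (t := 2 * t) (by omega) hz
  rw [norm_mul, Complex.norm_ofNat]
  push_cast at h2
  linarith

/-- `‖coldVolumeDiscrepancy ρ a a' t z‖ ≤ 96 t` on the disc (`a, a', t ≥ 1`). -/
theorem norm_coldVolumeDiscrepancy_le (hρ : Continuous ρ) {a a' t : ℕ} (ha : 0 < a) (ha' : 0 < a') (ht : 1 ≤ t) {z : ℂ}
    (hz : ‖z‖ ≤ strongCouplingRadius ρ) : ‖coldVolumeDiscrepancy ρ a a' t z‖ ≤ 96 * (t : ℝ) := by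
  unfold coldVolumeDiscrepancy
  refine (norm_sub_le _ _).trans ?_
  have h1 := norm_coldLogDefect_div_le ρ hρ ha' ht hz
  have h2 := norm_coldLogDefect_div_le ρ hρ ha ht hz
  linarith

/-- The cold log-defect is holomorphic on the open strong-coupling disc (two finite-box logarithms). -/
theorem differentiableOn_coldLogDefect (hρ : Continuous ρ) (a t : ℕ) :
    DifferentiableOn ℂ (coldLogDefect ρ a t) (Metric.ball 0 (strongCouplingRadius ρ)) := by
  have h := ((differentiableOn_tubeLogZ ρ hρ a t).const_mul (2 : ℂ)).sub (differentiableOn_tubeLogZ ρ hρ a (2 * t))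
  exact h.congr fun z _ => rfl

/-- The cold volume discrepancy is holomorphic on the open strong-coupling disc. -/
theorem differentiableOn_coldVolumeDiscrepancy (hρ : Continuous ρ) (a a' t : ℕ) :
    DifferentiableOn ℂ (coldVolumeDiscrepancy ρ a a' t) (Metric.ball 0 (strongCouplingRadius ρ)) := by
  have h := ((differentiableOn_coldLogDefect ρ hρ a' t).div_const ((a' : ℂ) ^ 3)).sub
    ((differentiableOn_coldLogDefect ρ hρ a t).div_const ((a : ℂ) ^ 3))
  exact h.congr fun z _ => rfl

/-- **Jets ⇒ estimate** (Schwarz lemma with multiplicity): `‖coldVolumeDiscrepancy ρ a a' t z‖ ≤ 96t·(‖z‖/(r_ρ/2))^k` for `‖z‖ ≤ r_ρ/2`. -/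
theorem norm_coldVolumeDiscrepancy_le_of_isBigO (hρ : Continuous ρ) {a a' t k : ℕ} (ha : 0 < a) (ha' : 0 < a') (ht : 1 ≤ t)
    (hO : (fun z : ℂ => coldVolumeDiscrepancy ρ a a' t z) =O[𝓝 (0 : ℂ)] fun z : ℂ => z ^ k)
    {z : ℂ} (hz : ‖z‖ ≤ strongCouplingRadius ρ / 2) :
    ‖coldVolumeDiscrepancy ρ a a' t z‖ ≤ 96 * (t : ℝ) * (‖z‖ / (strongCouplingRadius ρ / 2)) ^ k := by
  have hr := strongCouplingRadius_pos ρ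
  refine norm_le_of_isBigO_pow (differentiableOn_coldVolumeDiscrepancy ρ hρ a a' t) (fun w hw => ?_) hO (half_pos hr)
    (half_lt_self hr) hz
  rw [Metric.mem_ball, dist_zero_right] at hw
  exact norm_coldVolumeDiscrepancy_le ρ hρ ha ha' ht hw.le

end Analytic

/-! ## §2 Real coupling: the cold log-defect is `−log(1 − δᶜ)` -/

section RealCoupling

variable {G : Type*} [Group G] [TopologicalSpace G] [IsTopologicalGroup G] [CompactSpace G] [MeasurableSpace G] [BorelSpace G]
  [SecondCountableTopology G] {n : ℕ} (ρ : G →* Matrix (Fin n) (Fin n) ℂ)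

/-- At real `β ∈ [0, r_ρ]`: `Re coldLogDefect ρ a (m+2) β = −log(Z_β(a³×2(m+2))/Z_β(a³×(m+2))²)` (`Z = wilsonFinTorusPartition ρ β a a a ·`). -/
theorem re_coldLogDefect_ofReal (hρ : Continuous ρ) (hρu : ∀ g, ρ g ∈ Matrix.unitaryGroup (Fin n) ℂ) {β : ℝ} (hβ0 : 0 ≤ β)
    (hβ : β ≤ strongCouplingRadius ρ) (a m : ℕ) [NeZero a] :
    (coldLogDefect ρ a (m + 2) (β : ℂ)).re =
      -Real.log (wilsonFinTorusPartition ρ β a a a (2 * (m + 2)) / wilsonFinTorusPartition ρ β a a a (m + 2) ^ 2) := by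
  have h1 := re_tubeLogZ_ofReal ρ hρ hρu hβ0 hβ a (m + 2)
  have h2 := re_tubeLogZ_ofReal ρ hρ hρu hβ0 hβ a (2 * (m + 2))
  rw [← wilsonFinTorusPartition_eq_cyclicPartition hρ hρu] at h1 h2
  have hW1 := wilsonFinTorusPartition_pos hρ β a a a (m + 2)
  have hW2 := wilsonFinTorusPartition_pos hρ β a a a (2 * (m + 2))
  unfold coldLogDefect
  rw [Complex.sub_re, Complex.mul_re, h1]
  have h2' : (tubeLogZ ρ a (2 * (m + 2)) (β : ℂ)).re = Real.log (wilsonFinTorusPartition ρ β a a a (2 * (m + 2))) := by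
    convert h2 using 3
  rw [h2', Real.log_div hW2.ne' (pow_pos hW1 2).ne', Real.log_pow]
  norm_num

end RealCoupling

/-! ## §3 Uniform smallness of the cold trace excess off the diagonal -/

section Smallness

variable {G : Type*} [Group G] [TopologicalSpace G] [IsTopologicalGroup G] [CompactSpace G] [MeasurableSpace G] [BorelSpace G]
  [SecondCountableTopology G] {n : ℕ} {ρ : G →* Matrix (Fin n) (Fin n) ℂ}

/-- **Uniform smallness at volume-to-time ratio ≤ 20**: for every `ε > 0` there is `N₁` with `x_{m+2}(N) ≤ ε` for all `N ≥ N₁` with `N ≤ 20(m+2)` and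
ALL `0 ≤ β ≤ strongCouplingRadius ρ` — from `x_{m+2}(N) ≤ exp(12N³(m+2)e^{−⌊(m+2)/2⌋}) − 1`, `(m+2)e^{−(m+2)/4} ≤ 4` and `N³e^{−N/80} → 0`. -/
theorem traceExcess_small_of_le_twenty_mul (hρ : Continuous ρ) (hρu : ∀ g, ρ g ∈ Matrix.unitaryGroup (Fin n) ℂ) {ε : ℝ} (hε : 0 < ε) :
    ∃ N₁ : ℕ, ∀ β : ℝ, 0 ≤ β → β ≤ strongCouplingRadius ρ →
      ∀ (N : ℕ) [NeZero N] (m : ℕ), N₁ ≤ N → N ≤ 20 * (m + 2) → traceExcess ρ β N (m + 2) ≤ ε := by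
  have ht : Tendsto (fun u : ℝ => u ^ 3 * Real.exp (-u)) atTop (𝓝 0) := Real.tendsto_pow_mul_exp_neg_atTop_nhds_zero 3
  have hlog : 0 < Real.log (1 + ε) := Real.log_pos (by linarith)
  set η : ℝ := Real.log (1 + ε) / (48 * Real.exp (1 / 2) * 80 ^ 3) with hη
  have hηpos : 0 < η := by positivity
  obtain ⟨X, hX⟩ := eventually_atTop.1 ((tendsto_order.1 ht).2 η hηpos)
  refine ⟨⌈80 * X⌉₊, fun β hβ0 hβ N _ m hN hNm => ?_⟩
  have hmaj := traceExcess_le_of_strongCoupling ρ hρ hρu hβ0 hβ N m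
  set u : ℝ := (N : ℝ) / 80 with hu
  have huX : X ≤ u := by
    have h1 : (80 * X : ℝ) ≤ ⌈80 * X⌉₊ := Nat.le_ceil _
    have h2 : (⌈80 * X⌉₊ : ℝ) ≤ N := by exact_mod_cast hN
    rw [hu]; linarith
  have hu3 : u ^ 3 * Real.exp (-u) < η := hX u huX
  set s : ℝ := (m : ℝ) + 2 with hs
  have hs0 : 0 ≤ s := by positivity
  -- `⌊(m+2)/2⌋ ≥ (m+1)/2`, so `e^{−⌊(m+2)/2⌋} ≤ e^{1/2} e^{−s/2}`
  have hfl : 2 * ((m + 2) / 2) ≥ m + 1 := by omega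
  have hflR : -((((m + 2) / 2 : ℕ) : ℝ)) ≤ 1 / 2 + -(s / 2) := by
    have : ((m : ℝ) + 1) ≤ 2 * ((((m + 2) / 2 : ℕ)) : ℝ) := by exact_mod_cast hfl
    rw [hs]; linarith
  have hexp : Real.exp (-((((m + 2) / 2 : ℕ) : ℝ))) ≤ Real.exp (1 / 2) * (Real.exp (-(1 / 4 * s)) * Real.exp (-(s / 4))) := by
    rw [← Real.exp_add, ← Real.exp_add]
    exact Real.exp_le_exp.2 (by linarith)
  -- `s e^{−s/4} ≤ 4` and `e^{−s/4} ≤ e^{−u}` (`s ≥ N/20 = 4u`)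
  have hs4 : s * Real.exp (-(1 / 4 * s)) ≤ 4 := mul_exp_neg_quarter_le s
  have hsu : Real.exp (-(s / 4)) ≤ Real.exp (-u) := by
    refine Real.exp_le_exp.2 ?_
    have : (N : ℝ) ≤ 20 * ((m : ℝ) + 2) := by exact_mod_cast hNm
    rw [hu, hs]; linarith
  have hN3 : (N : ℝ) ^ 3 = 80 ^ 3 * u ^ 3 := by rw [hu]; ring
  have hE : 12 * (N : ℝ) ^ 3 * ((m : ℝ) + 2) * Real.exp (-((((m + 2) / 2 : ℕ) : ℝ))) ≤ Real.log (1 + ε) := by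
    rw [← hs]
    calc 12 * (N : ℝ) ^ 3 * s * Real.exp (-((((m + 2) / 2 : ℕ) : ℝ)))
        ≤ 12 * (N : ℝ) ^ 3 * s * (Real.exp (1 / 2) * (Real.exp (-(1 / 4 * s)) * Real.exp (-(s / 4)))) :=
          mul_le_mul_of_nonneg_left hexp (by positivity)
      _ = 12 * Real.exp (1 / 2) * (N : ℝ) ^ 3 * (s * Real.exp (-(1 / 4 * s))) * Real.exp (-(s / 4)) := by ring
      _ ≤ 12 * Real.exp (1 / 2) * (N : ℝ) ^ 3 * 4 * Real.exp (-u) := by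
          exact mul_le_mul (mul_le_mul_of_nonneg_left hs4 (by positivity)) hsu (by positivity) (by positivity)
      _ = 48 * Real.exp (1 / 2) * 80 ^ 3 * (u ^ 3 * Real.exp (-u)) := by rw [hN3]; ring
      _ ≤ 48 * Real.exp (1 / 2) * 80 ^ 3 * η := mul_le_mul_of_nonneg_left hu3.le (by positivity)
      _ = Real.log (1 + ε) := by rw [hη]; field_simp
  calc traceExcess ρ β N (m + 2)
      ≤ Real.exp (12 * (N : ℝ) ^ 3 * ((m : ℝ) + 2) * Real.exp (-((((m + 2) / 2 : ℕ) : ℝ)))) - 1 := hmaj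
    _ ≤ Real.exp (Real.log (1 + ε)) - 1 := by gcongr
    _ = ε := by rw [Real.exp_log (by linarith)]; ring

end Smallness

/-! ## §4 Assembly in the finite currency -/

/-- The defect bookkeeping: `δ' ≤ Δ'`, `Δ' ≤ 64Δ + η`, `Δ ≤ 2δ`, `δ ≤ 2x`, `η ≤ 4x`, `x' ≤ 2δ'` give `x' ≤ 520x`. -/
theorem excess_le_of_defect_le {x x' δ δ' Δ Δ' η : ℝ} (hδ'Δ' : δ' ≤ Δ') (hΔ' : Δ' ≤ 64 * Δ + η) (hΔδ : Δ ≤ 2 * δ)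
    (hδx : δ ≤ 2 * x) (hηx : η ≤ 4 * x) (hx'δ' : x' ≤ 2 * δ') : x' ≤ 520 * x := by
  linarith

/-- **THE SECOND ASSEMBLY OF LINE 7b (finite currency): `ColdFreeEnergyVolumeJets → TraceExcessFloorAllSides → TraceExcessVolumeComparisonSmallCoupling`.**
Window `β₁ = min(r_ρ/2, βF, 1, √(r_ρ³c/32))` with `c = min c₁ 1`; constant `K = 520`; sides `L ≥ max(N₀, L₁, N₁, 16)`.  Only the implication is proved;
both hypotheses are OPEN; no mass gap is claimed. -/
theorem traceExcessVolumeComparisonSmallCoupling_of_coldJets (hJ : ColdFreeEnergyVolumeJets) (hF : TraceExcessFloorAllSides) :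
    TraceExcessVolumeComparisonSmallCoupling := by
  intro G _ _ _ _
  letI : MeasurableSpace G := borel G
  haveI : BorelSpace G := ⟨rfl⟩
  intro r
  haveI : SecondCountableTopology G :=
    (r.continuous.isClosedEmbedding r.injective).isEmbedding.secondCountableTopology
  rcases subsingleton_or_nontrivial G with hG | hG
  · refine ⟨1, one_pos, 0, le_rfl, 0, fun β _ _ L _ L' _ m _ _ _ _ => ?_⟩
    rw [Escape.traceExcess_eq_zero_of_subsingleton r.ρ β (m + 2), Escape.traceExcess_eq_zero_of_subsingleton r.ρ β (m + 2),
      mul_zero]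
  obtain ⟨βF, c₁, N₀, hβF, hc₁, hfl⟩ := hF G r (latticeRep_re_trace_nonconst_of_nontrivial r)
  obtain ⟨L₁, hL₁⟩ := Rate.traceExcess_small_of_large r.continuous r.mem_unitary (ε := 1 / 64) (by norm_num)
  obtain ⟨N₁, hN₁⟩ := traceExcess_small_of_le_twenty_mul r.continuous r.mem_unitary (ε := 1) one_pos
  have hr0 : 0 < strongCouplingRadius r.ρ := strongCouplingRadius_pos r.ρ
  have hc0 : 0 < min c₁ 1 := lt_min hc₁ one_pos
  have hβ₁pos : 0 < min (strongCouplingRadius r.ρ / 2) (min βF (min 1 (Real.sqrt (strongCouplingRadius r.ρ ^ 3 * min c₁ 1 / 32)))) :=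
    lt_min (half_pos hr0) (lt_min hβF (lt_min one_pos (Real.sqrt_pos.2 (by positivity))))
  refine ⟨_, hβ₁pos, 520, by norm_num, max N₀ (max L₁ (max N₁ 16)), ?_⟩
  intro β hβ0 hβ L _ L' _ m hm hL hLL' hL'L
  set rr : ℝ := strongCouplingRadius r.ρ with hrr
  set c : ℝ := min c₁ 1 with hcdef
  have hc1 : c ≤ 1 := min_le_right _ _
  have hcc₁ : c ≤ c₁ := min_le_left _ _
  have hN₀L : N₀ ≤ L := le_trans (le_max_left _ _) hL
  have hL₁L : L₁ ≤ L := le_trans ((le_max_left _ _).trans (le_max_right _ _)) hL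
  have hN₁L : N₁ ≤ L := le_trans ((le_max_left _ _).trans ((le_max_right _ _).trans (le_max_right _ _))) hL
  have hL16 : 16 ≤ L := le_trans ((le_max_right _ _).trans ((le_max_right _ _).trans (le_max_right _ _))) hL
  have hβr2 : β ≤ rr / 2 := hβ.trans (min_le_left _ _)
  have hββF : β ≤ βF := hβ.trans ((min_le_right _ _).trans (min_le_left _ _))
  have hβ1 : β ≤ 1 := hβ.trans ((min_le_right _ _).trans ((min_le_right _ _).trans (min_le_left _ _)))
  have hβsq : β ≤ Real.sqrt (rr ^ 3 * c / 32) :=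
    hβ.trans ((min_le_right _ _).trans ((min_le_right _ _).trans (min_le_right _ _)))
  have hβr : β ≤ rr := by linarith
  have hratio : 8 * β ^ 2 / (rr ^ 3 * c) ≤ 1 / 4 := by
    have h1 : β ^ 2 ≤ rr ^ 3 * c / 32 := (Real.le_sqrt hβ0 (by positivity)).1 hβsq
    rw [div_le_iff₀ (by positivity)]
    linarith
  rcases hβ0.eq_or_lt with rfl | hβpos
  · rw [Escape.traceExcess_zero r.ρ (m + 2), Escape.traceExcess_zero r.ρ (m + 2), mul_zero]
  have ht4 : 4 ≤ m + 2 := by omega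
  have h4t : 4 * (m + 2) ≤ L := by omega
  have htL : m + 2 ≤ L := by omega
  have hLpos : 0 < L := by omega
  have hL'pos : 0 < L' := by omega
  have hL'20 : L' ≤ 20 * (m + 2) := by omega
  -- the two excesses, the two defects, the two log-defects
  set x : ℝ := traceExcess r.ρ β L (m + 2) with hxdef
  set x' : ℝ := traceExcess r.ρ β L' (m + 2) with hx'def
  have hx0 : 0 ≤ x := Rate.traceExcess_nonneg r.continuous r.mem_unitary hβ0 L m
  have hx'0 : 0 ≤ x' := Rate.traceExcess_nonneg r.continuous r.mem_unitary hβ0 L' m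
  have hx64 : x ≤ 1 / 64 := hL₁ β hβ0 hβr L m hm hL₁L
  have hx'1 : x' ≤ 1 := hN₁ β hβ0 hβr L' m (hN₁L.trans (by omega)) hL'20
  set W₁ : ℝ := wilsonFinTorusPartition r.ρ β L L L (m + 2) with hW₁
  set W₂ : ℝ := wilsonFinTorusPartition r.ρ β L L L (2 * (m + 2)) with hW₂
  set W₁' : ℝ := wilsonFinTorusPartition r.ρ β L' L' L' (m + 2) with hW₁'
  set W₂' : ℝ := wilsonFinTorusPartition r.ρ β L' L' L' (2 * (m + 2)) with hW₂'
  have hW₁pos : 0 < W₁ := wilsonFinTorusPartition_pos r.continuous β L L L (m + 2)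
  have hW₂pos : 0 < W₂ := wilsonFinTorusPartition_pos r.continuous β L L L (2 * (m + 2))
  have hW₁'pos : 0 < W₁' := wilsonFinTorusPartition_pos r.continuous β L' L' L' (m + 2)
  have hW₂'pos : 0 < W₂' := wilsonFinTorusPartition_pos r.continuous β L' L' L' (2 * (m + 2))
  set δ : ℝ := 1 - W₂ / W₁ ^ 2 with hδdef
  set δ' : ℝ := 1 - W₂' / W₁' ^ 2 with hδ'def
  have hq : 0 < W₂ / W₁ ^ 2 := div_pos hW₂pos (pow_pos hW₁pos 2)
  have hq' : 0 < W₂' / W₁' ^ 2 := div_pos hW₂'pos (pow_pos hW₁'pos 2)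
  -- dictionary at `(L, t)` and `(L', t)`
  have hδx : δ ≤ 2 * x := one_sub_ratio_le_two_mul_traceExcess r hβ0 L m
  have hxδ2 : 2 * x' / (1 + x') ^ 2 ≤ δ' := one_sub_ratio_ge_of_traceExcess r hβ0 L' m
  have hx'δ' : x' ≤ 2 * δ' := by
    have hsq : (1 + x') ^ 2 ≤ 4 := by nlinarith
    have hpos : 0 < (1 + x') ^ 2 := by positivity
    have h1 : 2 * x' / 4 ≤ 2 * x' / (1 + x') ^ 2 := div_le_div_of_nonneg_left (by linarith) hpos hsq
    linarith
  -- the log-defects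
  set Δ : ℝ := -Real.log (W₂ / W₁ ^ 2) with hΔdef
  set Δ' : ℝ := -Real.log (W₂' / W₁' ^ 2) with hΔ'def
  have hΔre : (coldLogDefect r.ρ L (m + 2) (β : ℂ)).re = Δ := re_coldLogDefect_ofReal r.ρ r.continuous r.mem_unitary hβ0 hβr L m
  have hΔ're : (coldLogDefect r.ρ L' (m + 2) (β : ℂ)).re = Δ' := re_coldLogDefect_ofReal r.ρ r.continuous r.mem_unitary hβ0 hβr L' m
  have hδ0 : 0 ≤ δ := DoublingDefect.coldDefect_nonneg r.continuous r.mem_unitary hβ0 L (m + 2) (by omega)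
  have hΔ0 : 0 ≤ Δ := by
    have : W₂ / W₁ ^ 2 ≤ 1 := by rw [hδdef] at hδ0; linarith
    rw [hΔdef, neg_nonneg]; exact Real.log_nonpos hq.le this
  have hΔδ : Δ ≤ 2 * δ := by
    -- `−log q ≤ 1/q − 1 = δ/q ≤ 2δ` for `q = 1 − δ ≥ 1/2`
    have hδhalf : δ ≤ 1 / 2 := by linarith
    have h1 : -Real.log (W₂ / W₁ ^ 2) ≤ (W₂ / W₁ ^ 2)⁻¹ - 1 := by
      have := Real.log_le_sub_one_of_pos (inv_pos.2 hq)
      rw [Real.log_inv] at this; linarith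
    have hqeq : W₂ / W₁ ^ 2 = 1 - δ := by rw [hδdef]; ring
    rw [hΔdef]
    refine h1.trans ?_
    rw [hqeq]
    have h1δ : (0 : ℝ) < 1 - δ := by linarith
    rw [inv_eq_one_div, div_sub_one h1δ.ne', div_le_iff₀ h1δ]
    nlinarith
  have hδ'Δ' : δ' ≤ Δ' := by
    -- `1 − q' ≤ −log q'`
    have := Real.add_one_le_exp (-Δ')
    have hqexp : Real.exp (-Δ') = W₂' / W₁' ^ 2 := by rw [hΔ'def, neg_neg, Real.exp_log hq']
    rw [hqexp] at this
    rw [hδ'def]; linarith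
  -- the discrepancy at real `β` and its Schwarz bound
  have hDeq : (coldVolumeDiscrepancy r.ρ L L' (m + 2) (β : ℂ)).re = Δ' / (L' : ℝ) ^ 3 - Δ / (L : ℝ) ^ 3 := by
    have e1 : ((L' : ℂ) ^ 3) = (((L' : ℝ) ^ 3 : ℝ) : ℂ) := by push_cast; ring
    have e2 : ((L : ℂ) ^ 3) = (((L : ℝ) ^ 3 : ℝ) : ℂ) := by push_cast; ring
    unfold coldVolumeDiscrepancy
    rw [Complex.sub_re, e1, e2, Complex.div_ofReal_re, Complex.div_ofReal_re, hΔre, hΔ're]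
  have hO := hJ G r L L' (m + 2) (by omega) (by omega) ht4
  have hz : ‖(β : ℂ)‖ ≤ strongCouplingRadius r.ρ / 2 := by
    rw [Complex.norm_real, Real.norm_eq_abs, abs_of_nonneg hβ0]; exact hβr2
  have hDn := norm_coldVolumeDiscrepancy_le_of_isBigO r.ρ r.continuous hLpos hL'pos (by omega) hO hz
  rw [Complex.norm_real, Real.norm_eq_abs, abs_of_nonneg hβ0] at hDn
  have hDabs : |(coldVolumeDiscrepancy r.ρ L L' (m + 2) (β : ℂ)).re| ≤ 96 * ((m + 2 : ℕ) : ℝ) * (β / (rr / 2)) ^ (3 * L) :=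
    (Complex.abs_re_le_norm _).trans hDn
  -- budget: `64L³·|D| ≤ 4(cβ)^L ≤ 4(cβ⁴)^t ≤ 4x`
  have hbudget := budget_le_pow (t := m + 2) hβ0 hr0 hc0 hratio htL hL16
  have hfloor : (c * β ^ 4) ^ (m + 2) ≤ x := by
    have h1 : (c * β ^ 4) ^ (m + 2) ≤ (c₁ * β ^ 4) ^ (m + 2) :=
      pow_le_pow_left₀ (by positivity) (mul_le_mul_of_nonneg_right hcc₁ (by positivity)) _
    exact h1.trans (hfl β hβpos hββF L hN₀L m)
  have hη : 64 * (L : ℝ) ^ 3 * |(coldVolumeDiscrepancy r.ρ L L' (m + 2) (β : ℂ)).re| ≤ 4 * x :=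
    calc 64 * (L : ℝ) ^ 3 * |(coldVolumeDiscrepancy r.ρ L L' (m + 2) (β : ℂ)).re|
        ≤ 64 * (L : ℝ) ^ 3 * (96 * ((m + 2 : ℕ) : ℝ) * (β / (rr / 2)) ^ (3 * L)) :=
          mul_le_mul_of_nonneg_left hDabs (by positivity)
      _ = 4 * (64 * (L : ℝ) ^ 3 * (24 * ((m + 2 : ℕ) : ℝ) * (β / (rr / 2)) ^ (3 * L))) := by ring
      _ ≤ 4 * (c * β) ^ L := by linarith [hbudget]
      _ ≤ 4 * (c * β ^ 4) ^ (m + 2) := by linarith [pow_le_floor hc0.le hc1 hβ0 hβ1 htL h4t]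
      _ ≤ 4 * x := by linarith [hfloor]
  have hΔ'le := log_le_of_discrepancy hLpos hL'L hΔ0 hDeq hL'pos hη
  exact excess_le_of_defect_le hδ'Δ' hΔ'le hΔδ hδx le_rfl hx'δ'

/-- **Line 7b in the finite currency down to its two hypotheses**: `ColdFreeEnergyVolumeJets → TraceExcessFloorAllSides →
ColdDoublingRecursionSmallCoupling`.  Only the implication is proved; no mass gap is claimed. -/
theorem coldDoublingRecursionSmallCoupling_of_coldJets (hJ : ColdFreeEnergyVolumeJets) (hF : TraceExcessFloorAllSides) :
    ColdDoublingRecursionSmallCoupling :=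
  coldDoublingRecursionSmallCoupling_of_volumeComparison (traceExcessVolumeComparisonSmallCoupling_of_coldJets hJ hF)

end Summit.QuantumFields.YangMills.Theorems.GlueballBandRecursion.Thermal

end
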